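import Literature.ModelTheory.Quasiminimal.KappaModel
import Literature.ModelTheory.Quasiminimal.ContinuumCCP
import Literature.ModelTheory.Quasiminimal.ContinuumStrong
import Literature.ModelTheory.Quasiminimal.ContinuumAxiomFour
import HarnessLib

/-!
# The axioms of the models over a linear order, and models of every infinite cardinality

For the model `S.Model I` of `KappaModel.lean` — the direct limit of the countable quasiminimal
chart `M` (an exponential field, `S : Setup L M cl`) along closed self-embeddings indexed by the
finite subsets of a linear order `I` — we transfer Bays–Kirby's axioms from the chart, exactly
as `ContinuumCCP.lean`, `ContinuumStrong.lean` and `ContinuumAxiomFour.lean` do for `I = ℝ`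
(their general lemmas — pulling Khovanskii systems back along E-field embeddings, invariance
of the predimension under injective E-field embeddings, descent of varieties to a chart,
`AxiomFourTransfer.lean` — are reused by import; only the bookkeeping in the direct limit, which
mentions the index order, is repeated):

* axiom 5, the **countable closure property**: `ecl^F(X)` is countable for finite `X ⊆ F`, as
  soon as `ecl ⊆ cl` in `M` (`Setup.countable_ecl_model`);
* axiom 3, **strongness of the base**: if the `ℚ`-span of the base is strong in `M` then it is
  strong in `F` (`Setup.isStrong_model`);
* axiom 4, **strong exponential-algebraic closedness over the base** (`Setup.axiom4_model`).

All three are instances of "all the axioms are preserved under unions of directed systems of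
closed embeddings" (Bays–Kirby 2018, proof of Thm 8.2). Together with `KappaModel.lean`
(cardinality `#I`, algebraic closedness, surjectivity of `exp`, kernel) this gives
`Setup.exists_kappaModel_over_base`: over the base of the chart there are such exponential
fields of **every infinite cardinality `κ`** (take `I = κ.ord.ToType`) — Kirby 2010, Thm 4.2 /
Bays–Hart–Hyttinen–Kesälä–Kirby 2014, Thm 2.3 (existence of a model of every cardinal
dimension), as used in Bays–Kirby 2018, Thm 1.7 / Thm 8.2, and, for Zilber's
pseudo-exponentiation, Zilber 2005, Thm 1.1 / §5 (a model of the axioms in every uncountable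
cardinality). `ContinuumAssembly.lean` is the case `κ = 𝔠` (which moreover records
quasiminimality, not repeated here).

## References

* M. Bays, J. Kirby, *Pseudo-exponential maps, variants, and quasiminimality*, Algebra & Number
  Theory 12 (2018), Thm 1.7, Thm 8.2 (proof), Thm 9.1 (3)–(5).
* J. Kirby, *On quasiminimal excellent classes*, J. Symbolic Logic 75 (2010), Thm 4.2.
* M. Bays, B. Hart, T. Hyttinen, M. Kesälä, J. Kirby, *Quasiminimal structures and excellence*,
  Bull. LMS 46 (2014), Thm 2.3.
* B. Zilber, *Pseudo-exponentiation on algebraically closed fields of characteristic zero*,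
  Ann. Pure Appl. Logic 132 (2005), Thm 1.1, §5.
-/

noncomputable section

suppress_compilation

open Set Cardinal
open Literature.ModelTheory.ExponentialFields

namespace Literature.ModelTheory.Quasiminimal

namespace Setup

open FirstOrder FirstOrder.Language

variable {L : Language.{0, 0}} {M : Type} [L.Structure M] [Field M] [ExponentialRing M]
  {cl : Set M → Set M} (S : Setup L M cl) {I : Type} [LinearOrder I]

section TransferPart

open FirstOrder FirstOrder.Language
open Literature.NumberTheory.Transcendental Literature.NumberTheory.Transcendental.GammaField


/-! ### The countable closure property -/

/-- **`ecl` in the model is computed in a chart**: for `X̃ ⊆ M` and a chart `Z₀`,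
`ecl^F ([X̃]_{Z₀}) ⊆ [cl^M X̃]_{Z₀}` as soon as `ecl ⊆ cl` in `M`.
[cite: BaysKirby2018ANT, Thm 8.2 (proof)] -/
theorem ecl_subset_image_cl_model (hecl : ∀ A : Set M, ecl A ⊆ cl A) (Z₀ : Finset I)
    (Xt : Set M) : ecl (S.chart I Z₀ '' Xt) ⊆ S.chart I Z₀ '' cl Xt := by
  classical
  intro a ha
  obtain ⟨ι, _, _, x, g, hsol, i, rfl⟩ := Khovanskii.mem_ecl_iff.mp ha
  -- a chart containing the unknowns and `Z₀`
  obtain ⟨W₀, xt₀, hxt₀⟩ := S.exists_chart_family_model x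
  set W := Z₀ ∪ W₀ with hWdef
  have hZ : Z₀ ⊆ W := Finset.subset_union_left
  have hW₀ : W₀ ⊆ W := Finset.subset_union_right
  set xt : ι → M := S.sys I W₀ W ∘ xt₀ with hxt
  have hx : S.chart I W ∘ xt = x := by
    rw [← hxt₀]; exact funext fun k => S.chart_sys hW₀ (xt₀ k)
  -- the parameters, read in the chart `W`
  set C : Set M := S.sys I Z₀ W '' Xt with hC
  have hCim : S.chart I W '' C = S.chart I Z₀ '' Xt := by
    rw [hC, image_image]; exact image_congr fun m _ => S.chart_sys hZ m
  -- pull the system back to `M`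
  let φ : ExponentialRingHom M (S.Model I) := ExpDirectLimit.ofExp S.sysHom W
  have hφ : (φ : M → S.Model I) = S.chart I W := rfl
  have hsol' : Khovanskii.IsSol (φ '' C) (φ ∘ xt) g := by rwa [hφ, hCim, hx]
  have hmem := Khovanskii.mem_image_ecl_of_isSol φ hsol' i
  rw [hφ] at hmem
  obtain ⟨m, hm, hmx⟩ := hmem
  -- `ecl ⊆ cl` in `M`, and `cl` commutes with `sys`
  have hm' : m ∈ S.sys I Z₀ W '' cl Xt := by
    rw [S.image_cl_sys hZ]; exact hecl _ hm
  obtain ⟨m₀, hm₀, rfl⟩ := hm'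
  refine ⟨m₀, hm₀, ?_⟩
  rw [← S.chart_sys hZ m₀, hmx]
  exact congr_fun hx i

/-- **Countable closure property of the models** (axiom 5 of Bays–Kirby 2018, Thm 8.2 / 9.1,
for the model over any linear order): `ecl^F (X)` is countable for every finite `X ⊆ F`, as
soon as `ecl ⊆ cl` in the countable quasiminimal chart `M`. [cite: BaysKirby2018ANT, Thm 9.1 (5)] -/
theorem countable_ecl_model (hecl : ∀ A : Set M, ecl A ⊆ cl A) (X : Set (S.Model I))
    (hX : X.Finite) : (ecl X).Countable := by
  classical
  haveI := S.countable
  haveI := hX.fintype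
  obtain ⟨Z₀, xt, hxt⟩ := S.exists_chart_family_model (fun a : X => (a : S.Model I))
  have hXeq : X = S.chart I Z₀ '' range xt := by
    ext a
    constructor
    · intro ha
      exact ⟨xt ⟨a, ha⟩, mem_range_self _, congr_fun hxt ⟨a, ha⟩⟩
    · rintro ⟨_, ⟨b, rfl⟩, rfl⟩
      have := congr_fun hxt b
      simp only [Function.comp_apply] at this
      rw [this]; exact b.2
  rw [hXeq]
  exact ((S.isWQPS.countable_cl _ (finite_range xt)).image (S.chart I Z₀)).mono
    (S.ecl_subset_image_cl_model hecl Z₀ (range xt))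

/-! ### Strongness of the base -/

variable (I) in
/-- The chart embeddings as E-ring morphisms. [folklore] -/
abbrev chartExp (W : Finset I) : ExponentialRingHom M (S.Model I) :=
  ExpDirectLimit.ofExp S.sysHom W

/-- Unfolding `chartExp`. [folklore] -/
@[simp] theorem chartExp_apply (W : Finset I) (m : M) : S.chartExp I W m = S.chart I W m := rfl

variable {K : Type} [Field K] (ιM : K →+* M)
  (hfix : ∀ σ : M → M, IsQFEmbOn L σ Set.univ → ∀ k, σ (ιM k) = ιM k)

include hfix in
/-- The base inside the model, read in any chart. [folklore] -/
theorem span_baseEmb_eq_map [CharZero M] (W : Finset I) (D : Set K) :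
    Submodule.span ℚ (S.baseEmb I ιM '' D) =
      (Submodule.span ℚ (ιM '' D)).map (linearOf (S.chartExp I W)) := by
  rw [Submodule.map_span]
  congr 1
  rw [image_image]
  refine image_congr fun x _ => ?_
  rw [linearOf_apply, chartExp_apply, S.chart_ιM ιM hfix W x]

include hfix in
/-- **Strongness of the base transfers to the models** (Bays–Kirby 2018 axiom 3, for the model
over any linear order): if the `ℚ`-span of the base is strong in the chart `M`, it is strong in
`S.Model I`, because every finitely generated extension of the base lies in one chart and `δ` is
invariant under the chart embedding. [cite: BaysKirby2018ANT, Thm 8.2 (proof)] -/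
theorem isStrong_model [CharZero M] {D : Set K} (hD : IsStrong (Submodule.span ℚ (ιM '' D))) :
    IsStrong (Submodule.span ℚ (S.baseEmb I ιM '' D)) := by
  intro Λ' hle hfg
  obtain ⟨s, hs, hΛ'⟩ := isFG_iff_exists_finset.1 hfg
  have hΛ'eq : Λ' = Submodule.span ℚ (S.baseEmb I ιM '' D) ⊔
      Submodule.span ℚ (s : Set (S.Model I)) :=
    le_antisymm hΛ' (sup_le hle (Submodule.span_le.2 hs))
  obtain ⟨W, t, hst⟩ := S.exists_chart_finset_model s
  set j := linearOf (S.chartExp I W) with hj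
  have hspan : Submodule.span ℚ (s : Set (S.Model I)) = (Submodule.span ℚ (t : Set M)).map j := by
    rw [Submodule.map_span, hst]; rfl
  rw [hΛ'eq, S.span_baseEmb_eq_map ιM hfix W D, hspan, ← Submodule.map_sup, predim_map]
  exact hD le_sup_left ((isFG_sup_left).2 (isFG_span_finset _ t))

end TransferPart

section AxiomFourPart

open MvPolynomial
open Literature.NumberTheory.Transcendental Literature.NumberTheory.Transcendental.ChartTransfer

/-- A closed subset of `F^{n ⊕ n}`, `F = S.Model I`, is cut out by finitely many polynomials with
coefficients in one chart. [folklore] -/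
theorem exists_chart_definedOver_model {n : ℕ} {W : Set (Fin n ⊕ Fin n → S.Model I)}
    (hW : IsZariskiClosed (S.Model I) W) (A : Finset (S.Model I)) :
    ∃ (Z₀ : Finset I) (G : Set (MvPolynomial (Fin n ⊕ Fin n) M)) (AM : Finset M),
      (letI : Algebra M (S.Model I) := (S.chart I Z₀).toAlgebra
       W = zeroLocus (S.Model I) (Ideal.span G)) ∧
        (A : Set (S.Model I)) = S.chart I Z₀ '' ↑AM := by
  classical
  obtain ⟨J, hJ⟩ := hW
  obtain ⟨GF, hGF⟩ := (isNoetherianRing_iff_ideal_fg _).1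
    (inferInstance : IsNoetherianRing (MvPolynomial (Fin n ⊕ Fin n) (S.Model I))) J
  obtain ⟨Z₀, t, ht⟩ := S.exists_chart_finset_model (GF.biUnion MvPolynomial.coeffs ∪ A)
  have hcoef : ∀ g ∈ GF, (↑g.coeffs : Set (S.Model I)) ⊆ Set.range (S.chart I Z₀) := by
    intro g hg c hc
    have : c ∈ ((GF.biUnion MvPolynomial.coeffs ∪ A : Finset (S.Model I)) : Set (S.Model I)) :=
      Finset.mem_coe.2 (Finset.mem_union_left _ (Finset.mem_biUnion.2 ⟨g, hg, hc⟩))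
    rw [ht] at this
    obtain ⟨m, -, hm⟩ := this
    exact ⟨m, hm⟩
  have hAim : ∀ a ∈ A, ∃ m ∈ t, S.chart I Z₀ m = a := by
    intro a ha
    have : a ∈ ((GF.biUnion MvPolynomial.coeffs ∪ A : Finset (S.Model I)) : Set (S.Model I)) :=
      Finset.mem_coe.2 (Finset.mem_union_right _ ha)
    rw [ht] at this
    obtain ⟨m, hm, hma⟩ := this
    exact ⟨m, hm, hma⟩
  letI : Algebra M (S.Model I) := (S.chart I Z₀).toAlgebra
  have hlift : ∀ g : GF, ∃ g' : MvPolynomial (Fin n ⊕ Fin n) M,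
      MvPolynomial.map (algebraMap M (S.Model I)) g' = g := by
    intro g
    have : (g : MvPolynomial (Fin n ⊕ Fin n) (S.Model I)) ∈
        Set.range (MvPolynomial.map (algebraMap M (S.Model I))) := by
      rw [mem_range_map_iff_coeffs_subset]
      exact hcoef g g.2
    exact this
  choose lift hlift' using hlift
  choose pre hpre hpre' using hAim
  refine ⟨Z₀, Set.range lift, A.attach.image fun a => pre a.1 a.2, ?_, ?_⟩
  · rw [hJ, ← hGF, zeroLocus_span, zeroLocus_span]
    ext x
    simp only [mem_setOf_eq, Finset.mem_coe, Set.mem_range]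
    constructor
    · rintro hx _ ⟨g, rfl⟩
      rw [← aeval_map_algebraMap (S.Model I), hlift']
      exact hx g g.2
    · intro hx g hg
      have := hx (lift ⟨g, hg⟩) ⟨⟨g, hg⟩, rfl⟩
      rwa [← aeval_map_algebraMap (S.Model I), hlift'] at this
  · ext a
    simp only [Finset.coe_image, mem_image, Finset.mem_coe, Finset.mem_attach, true_and,
      Subtype.exists]
    constructor
    · intro ha
      exact ⟨_, ⟨a, ha, rfl⟩, hpre' a ha⟩
    · rintro ⟨_, ⟨b, hb, rfl⟩, rfl⟩
      rw [hpre' b hb]; exact hb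

variable {K : Type} [Field K] (ιM : K →+* M)
  (hfix : ∀ σ : M → M, IsQFEmbOn L σ Set.univ → ∀ k, σ (ιM k) = ιM k)

include hfix in
/-- **Axiom 4 transfers to the models over a linear order.** If the chart `M` is algebraically
closed and satisfies Bays–Kirby's strong exponential-algebraic closedness over the base `ιM[D]`,
then so does `S.Model I` over `baseEmb[D]`. [cite: BaysKirby2018ANT, Thm 8.2 (4) (proof)] -/
theorem axiom4_model [CharZero M] [IsAlgClosed M] (D : Set K)
    (h4 : ∀ (n : ℕ) (W : Set (Fin n ⊕ Fin n → M)), IsIrreducibleClosed M W →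
      (W ∩ torusLocus M n).Nonempty → IsRotund M n (W ∩ torusLocus M n) →
      IsAddFree M n (W ∩ torusLocus M n) → IsMulFree M n (W ∩ torusLocus M n) →
      zariskiDim M W = n →
      ∀ A : Finset M, ∃ z ∈ W ∩ expGraph M n,
        ∀ m : Fin n → ℤ, (∑ i, (m i : M) * z (Sum.inl i)) ∈
          Submodule.span ℚ (ιM '' D ∪ ↑A) → m = 0) :
    ∀ (n : ℕ) (W : Set (Fin n ⊕ Fin n → S.Model I)), IsIrreducibleClosed (S.Model I) W →
      (W ∩ torusLocus (S.Model I) n).Nonempty →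
      IsRotund (S.Model I) n (W ∩ torusLocus (S.Model I) n) →
      IsAddFree (S.Model I) n (W ∩ torusLocus (S.Model I) n) →
      IsMulFree (S.Model I) n (W ∩ torusLocus (S.Model I) n) →
      zariskiDim (S.Model I) W = n →
      ∀ A : Finset (S.Model I), ∃ z ∈ W ∩ expGraph (S.Model I) n,
        ∀ m : Fin n → ℤ, (∑ i, (m i : S.Model I) * z (Sum.inl i)) ∈
          Submodule.span ℚ (S.baseEmb I ιM '' D ∪ ↑A) → m = 0 := by
  classical
  haveI : IsAlgClosed (S.Model I) := S.isAlgClosed_model I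
  intro n W hW hne hrot hadd hmul hdim A
  obtain ⟨Z₀, G, AM, hWG, hA⟩ := S.exists_chart_definedOver_model hW.1 A
  letI : Algebra M (S.Model I) := (S.chart I Z₀).toAlgebra
  have halg : algebraMap M (S.Model I) = S.chart I Z₀ := rfl
  -- the variety of `M`-points and its properties
  set WM : Set (Fin n ⊕ Fin n → M) :=
    zeroLocus M (contract (M := M) (vanishingIdeal (S.Model I) W)) with hWM
  have h1 : IsIrreducibleClosed M WM := isIrreducibleClosed_zeroLocus_contract hW
  have h2 : (WM ∩ torusLocus M n).Nonempty := nonempty_zeroLocus_contract_inter_torus hW hne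
  have h3 : IsRotund M n (WM ∩ torusLocus M n) := isRotund_zeroLocus_contract hW hWG hne hrot
  have h4a : IsAddFree M n (WM ∩ torusLocus M n) := isAddFree_zeroLocus_contract hW hadd
  have h4m : IsMulFree M n (WM ∩ torusLocus M n) := isMulFree_zeroLocus_contract hW hmul
  have h5 : zariskiDim M WM = n := by rw [hWM, zariskiDim_zeroLocus_contract hW hWG, hdim]
  -- solve in `M`
  obtain ⟨zt, ⟨hzW, hzexp⟩, hzind⟩ := h4 n WM h1 h2 h3 h4a h4m h5 AM
  refine ⟨S.chart I Z₀ ∘ zt, ⟨?_, ?_⟩, fun m hm => hzind m ?_⟩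
  · exact (mem_zeroLocus_contract_iff hWG zt).1 hzW
  · intro i
    simp only [Function.comp_apply]
    rw [hzexp i, S.exp_chart]
  · -- pull the linear condition back along the injective `ℚ`-linear chart map
    set j := GammaField.linearOf (S.chartExp I Z₀) with hj
    have hjof : ∀ x, j x = S.chart I Z₀ x := fun x => rfl
    have hspan : Submodule.span ℚ (S.baseEmb I ιM '' D ∪ ↑A) =
        (Submodule.span ℚ (ιM '' D ∪ ↑AM)).map j := by
      rw [Submodule.map_span, Set.image_union, hA, Set.image_image]
      congr 2
      exact Set.image_congr fun x _ => by rw [hjof, S.chart_ιM ιM hfix Z₀ x]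
    have hsum : (∑ i, (m i : S.Model I) * (S.chart I Z₀ ∘ zt) (Sum.inl i)) =
        j (∑ i, (m i : M) * zt (Sum.inl i)) := by
      rw [hjof, map_sum]
      refine Finset.sum_congr rfl fun i _ => ?_
      rw [map_mul, map_intCast, Function.comp_apply]
    rw [hspan, hsum] at hm
    obtain ⟨y, hy, hyx⟩ := Submodule.mem_map.1 hm
    rwa [← GammaField.linearOf_injective (S.chartExp I Z₀) hyx]

end AxiomFourPart

section AssemblyPart

open Literature.ModelTheory.ExponentialFields.ExponentialRing
open Literature.NumberTheory.Transcendental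

include S in
/-- **Models of every infinite cardinality over a base** (Kirby 2010, Thm 4.2 / BHHKK 2014,
Thm 2.3, existence, applied as in Bays–Kirby 2018, Thm 8.2 / Thm 1.7 to the countable chart of
an exponential field over a base): for every infinite cardinal `κ` (in universe `0`), the model
`S.Model κ.ord.ToType` is an exponential field `F` of cardinality exactly `κ`, algebraically
closed with surjective exponential, extending `(K, D, θ)` with kernel `ℤ · ι τ`, with strong
base, axiom 4 over the base and the countable closure property — given the corresponding
properties of the chart `M` (`ContinuumAssembly.lean` is the case `κ = 𝔠`, which moreover
records quasiminimality). [cite: Kirby2010QMEC, Thm 4.2] [cite: BaysKirby2018ANT, Thm 8.2] -/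
theorem exists_kappaModel_over_base [CharZero M] [IsAlgClosed M]
    {K : Type} [Field K] [CharZero K] (D : Submodule ℚ K) (θ : K → K) (τ : K) (ιM : K →+* M)
    (hfix : ∀ σ : M → M, IsQFEmbOn L σ Set.univ → ∀ k, σ (ιM k) = ιM k)
    (hsurj : IsSurjectiveOntoUnits M)
    (hexp : ∀ x ∈ D, exp (ιM x) = ιM (θ x))
    (hker : expKernel M = AddSubgroup.zmultiples (ιM τ))
    (hstrong : GammaField.IsStrong (Submodule.span ℚ (ιM '' D)))
    (h4 : ∀ (n : ℕ) (W : Set (Fin n ⊕ Fin n → M)), IsIrreducibleClosed M W →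
      (W ∩ torusLocus M n).Nonempty → IsRotund M n (W ∩ torusLocus M n) →
      IsAddFree M n (W ∩ torusLocus M n) → IsMulFree M n (W ∩ torusLocus M n) →
      zariskiDim M W = n →
      ∀ A : Finset M, ∃ z ∈ W ∩ expGraph M n,
        ∀ m : Fin n → ℤ, (∑ i, (m i : M) * z (Sum.inl i)) ∈
          Submodule.span ℚ (ιM '' D ∪ ↑A) → m = 0)
    (hecl : ∀ A : Set M, ecl A ⊆ cl A) (κ : Cardinal.{0}) (hκ : ℵ₀ ≤ κ) :
    ∃ (F : Type) (_ : Field F) (_ : CharZero F) (_ : ExponentialRing F) (ι : K →+* F),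
      #F = κ ∧ IsAlgClosed F ∧ IsSurjectiveOntoUnits F ∧
      (∀ x ∈ D, exp (ι x) = ι (θ x)) ∧ expKernel F = AddSubgroup.zmultiples (ι τ) ∧
      GammaField.IsStrong (Submodule.span ℚ (ι '' D)) ∧
      (∀ (n : ℕ) (W : Set (Fin n ⊕ Fin n → F)), IsIrreducibleClosed F W →
        (W ∩ torusLocus F n).Nonempty → IsRotund F n (W ∩ torusLocus F n) →
        IsAddFree F n (W ∩ torusLocus F n) → IsMulFree F n (W ∩ torusLocus F n) →
        zariskiDim F W = n →
        ∀ A : Finset F, ∃ z ∈ W ∩ expGraph F n,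
          ∀ m : Fin n → ℤ, (∑ i, (m i : F) * z (Sum.inl i)) ∈
            Submodule.span ℚ (ι '' D ∪ ↑A) → m = 0) ∧
      (∀ X : Set F, X.Finite → (ecl X).Countable) := by
  set I : Type := κ.ord.ToType with hI
  haveI : Infinite I := Cardinal.infinite_iff.2 (by rw [hI, Cardinal.mk_ord_toType]; exact hκ)
  exact ⟨S.Model I, inferInstance, inferInstance, inferInstance, S.baseEmb I ιM,
    by rw [S.mk_model I, hI, Cardinal.mk_ord_toType], S.isAlgClosed_model I,
    S.isSurjectiveOntoUnits_model I hsurj, S.exp_baseEmb ιM hexp, S.expKernel_model_eq ιM hfix hker,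
    S.isStrong_model ιM hfix hstrong, S.axiom4_model ιM hfix (D : Set K) h4,
    S.countable_ecl_model hecl⟩

end AssemblyPart

end Setup

end Literature.ModelTheory.Quasiminimal

end
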